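import Summits.BirchSwinnertonDyer.Rank1Residual.X2.HidaLimitRoad
import Summits.BirchSwinnertonDyer.Rank1Residual.X2.HidaLimitInputs
import HarnessLib

/-!
# O9 (row B11), road H: INPUTS ⟹ OUTPUT as named predicates — `HidaLimitInputsAt W p →
# HidaLimitRevDivOnTree W p` (cell `bsd-eis`, seat `bsd-eis-cgshw` g8; crux 4 `BSDpOnCellC`, line b1;
# the 10-line bridge announced in `X2/HidaLimitInputs.lean` p429440; THEOREMS ONLY)

HONEST FRAMING (cell `bsd-eis`): theorems only; nothing asserted; X2 stays CONSTRUCTION-SHAPED; no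
label or count moves. `X2/HidaLimitInputs.lean` (p429440) proved road H's output POINTWISE
(`C_pow_mul_map_mem_of_hidaLimitInputs`) and glued it to c3/c3s; `X2/HidaLimitRoad.lean` (p419866)
named the output `HidaLimitRevDivOnTree W p`. This file states the implication between the two NAMED
predicates (both sign-free), so that the stub bookkeeping of line b1 can cite either: road H's residual
is `HidaLimitInputsAt` (inputs: (α) + control, (d), (b), finite-submodule bound — each with a
memo-level derivation, cgshw MEMO-8 v1.3 / MEMO-9 v1.3, referee g23 PASS) and everything downstream
of it is kernel. [cite: KellerYin2024, §5.1 (a)–(e), Lemma 5.1.2 (arXiv:2402.12781v2)]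
-/

set_option autoImplicit false

noncomputable section

open scoped Classical MatrixGroups ModularForm

open CongruenceSubgroup WeierstrassCurve NumberField IsDedekindDomain Field PowerSeries
  Literature.NumberTheory.EllipticCurves Literature.NumberTheory.EllipticCurves.GreenbergSelmer
  Literature.NumberTheory.EllipticCurves.ModularForms
  Literature.NumberTheory.EllipticCurves.Rank1Residual
  Literature.NumberTheory.EllipticCurves.Rank1Residual.Typed
  Literature.NumberTheory.GaloisRepresentations Literature.NumberTheory.GaloisCohomology
  Literature.NumberTheory.Automorphic
  Summit.BirchSwinnertonDyer.Rank1Residual.X11b.AcSelmer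
  Summit.BirchSwinnertonDyer.Rank1Residual.X11b.Halves
  Summit.BirchSwinnertonDyer.Rank1Residual.X11b

namespace Summit.BirchSwinnertonDyer.Rank1Residual.X2

variable {W : WeierstrassCurve ℚ} [W.IsElliptic] [W.IsGloballyMinimal] {p : ℕ} [Fact p.Prime]

omit [W.IsGloballyMinimal] in
/-- **Road H: INPUTS ⟹ OUTPUT** — `HidaLimitInputsAt W p → HidaLimitRevDivOnTree W p` (both sign-free;
the one-sided reverse congruence limit of p428978 at every datum, `X_ac^∅` finitely generated by
`XAc.module_finite_empty`). CONDITIONAL on the typed inputs; nothing booked.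
[cite: KellerYin2024, §5.1 (a)–(e) and Lemma 5.1.2 (arXiv:2402.12781v2)]
[cite: Skinner2016PacificMC, §3.1 (p. 192)] -/
theorem hidaLimitRevDivOnTree_of_hidaLimitInputs (hin : HidaLimitInputsAt W p) :
    HidaLimitRevDivOnTree W p := by
  intro N _ K _ _ Dt H ιK P hc hN hK hd4 hHN hLt hP hcM hPinf κ hκ γ _ 𝔭 h𝔭 he hf f hfW ι' hι'
    ΩK Ωp L hΩK hL F hchar
  exact C_pow_mul_map_mem_of_hidaLimitInputs hin N K Dt H ιK P hc hN hK hd4 hHN hLt hP hcM hPinf κ hκ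
    γ 𝔭 h𝔭 he hf f hfW ι' hι' ΩK Ωp L hΩK hL F hchar

omit [W.IsGloballyMinimal] in
/-- **The IMC atom at both signs, final bookkeeping form for line b1's stub c3**: (Kolyvagin halves ∨
road H's INPUTS) ∧ Keller–Yin D′ at both signs ⟹ c3 ∧ c3s — `imcEq_both_signs_of_div_or_hidaLimitRevDiv_of_muLambda`
(p419866) with road H's residual pushed back from its output to its inputs. CONDITIONAL; nothing booked.
[folklore] -/
theorem imcEq_both_signs_of_div_or_inputs_of_muLambda
    (h : (NonsplitKolyvaginDivOnTree W p ∧ SplitKolyvaginDivOnTree W p) ∨ HidaLimitInputsAt W p)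
    (hml : NonsplitMuLambdaOnTree W p) (hmls : SplitMuLambdaOnTree W p) :
    NonsplitIMCEqOnTree W p ∧ SplitIMCEqOnTree W p :=
  imcEq_both_signs_of_div_or_hidaLimitRevDiv_of_muLambda
    (h.imp_right hidaLimitRevDivOnTree_of_hidaLimitInputs) hml hmls

end Summit.BirchSwinnertonDyer.Rank1Residual.X2

end
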